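import Literature.Topology.FourManifolds.BlowDownModelSphere
import Literature.Topology.FourManifolds.BandThickening
import Literature.Topology.FourManifolds.StraightLineIsotopyExtension
import HarnessLib

/-!
# Flattening charts of smooth spanning discs; leaf (C) `Knot.blowDownModel` discharged

Topic `Literature/Topology/FourManifolds`; last step of the discharge of leaf **(C)**
`Literature.Topology.FourManifolds.Knot.blowDownModel` (`KirbyMovesBlowDown.lean`) of the
blow-down invariance of surgery (`FramedLink.IsBlowDown.isSurgery`; R. C. Kirby, *The Topology
of 4-Manifolds*, LNM 1374 (1989), Ch. I §5, Thm. 5.1, move (2)). `BlowDownModelSphere.lean`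
reduced it to `Knot.ExistsFlatChart`: every smooth disc `d : ℝ² → S³` (`IsSmoothDisc d`:
`C^∞`, injective and immersive on the closed unit disc) with boundary the knot `K` is
*flattened* by a chart — an injective local diffeomorphism `Γ` of an open neighbourhood of the
flat closed unit disc of `ℝ³` into `S³` with `Γ (x, 0) = d x` for `‖x‖ ≤ 1`. This file proves it
(`Knot.existsFlatChart_holds`) by **thickening the disc along its normal field** (Hirsch,
*Differential Topology* (1976), Ch. 4 §5, Thms. 5.1–5.2: the map `(x, y) ↦ x + y` on a field of
transverse lines is a local diffeomorphism along the zero section and embeds a neighbourhood of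
it), and concludes

* `Knot.blowDownModel_holds : Knot.blowDownModel`.

## The construction (`namespace FlatteningChart`)

* the normal field is the tree's `patchNormal d` (`BandThickening.lean`: the tangent vector to
  `S³` at `d x` whose coordinates in the quaternion frame are the cross product of those of
  `∂₀ d x`, `∂₁ d x`; smooth, orthogonal to `d x` and to the image of the differential, nonzero
  where `d` is an immersion); this file adds the converse `injective_fderiv_of_patchNormal_ne_zero`
  and the openness of the non-vanishing locus, whence the normal field is nonzero and `d` is an
  immersion on a closed disc of radius `R = 1 + margin` (`exists_radius_patchNormal_ne_zero`).
* `discB = d ∘ univBall 0 R`, the disc reparametrised over the whole plane (Mathlib's smooth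
  `OpenPartialHomeomorph.univBall`), an immersion everywhere with the normal framing
  `framingB = (patchNormal d ∘ univBall 0 R)` (`isNormalFraming_framingB`, an instance of the
  tree's `IsNormalFraming`, `FramedTubularNbhd.lean`; compare `isNormalFraming_squeezed` of
  `BandThickening.lean` for square patches), whose core map
  `core (x, u) = (discB x + u₀ N x)/‖…‖` is a local diffeomorphism along the zero section
  (`IsNormalFraming.isLocalDiffeomorphAt_core_zero`) and injective on an open neighbourhood of the
  zero section over the compact `ρ⁻¹(D̄²)` (`exists_isOpen_injOn_of_isCompact`,
  `StraightLineIsotopyExtension.lean`, from the injectivity of `d` on `D̄²`).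
* `Λ (x, y, z) = (ρ⁻¹ (x, y), z)` straightens `{(x, y) ∈ B(0, R)} ⊆ ℝ³` onto `ℝ² × ℝ¹`
  (a `PartialDiffeomorph`, `ΛPD`); the chart is `Γ = core ∘ Λ` on
  `Ω = Λ⁻¹ (injectivity ∩ local-diffeomorphism region)`, and `Γ (x, 0) = d x` on the ball.

## References

* M. W. Hirsch, *Differential Topology*, GTM 33, Springer (1976), Ch. 4 §5, Thms. 5.1–5.2.
  [cite: Hirsch1976, §4.5 Thms 5.1–5.2]
* R. C. Kirby, *The Topology of 4-Manifolds*, LNM 1374, Springer (1989), Ch. I §5, Thm. 5.1.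
  [cite: Kirby1989, Ch. I §5 Thm 5.1]

## Design notes

* The reparametrisation by `univBall` makes the base of the normal framing the model space `ℝ²`
  itself (no open-subset manifolds); only the values of `d` on the ball of radius `R` enter.
* The normal field and its basic properties are the tree's `patchNormal` API of
  `BandThickening.lean` (square patches); only the converse implications
  (`injective_fderiv_of_patchNormal_ne_zero`, `injective_mfderiv_of_injective_fderiv_coe`) and
  the openness of the non-vanishing locus are added here.
* No declaration in this file uses `sorry`; `Knot.blowDownModel_holds` depends only on the axioms
  `propext`, `Classical.choice`, `Quot.sound`.
-/

open scoped Manifold ContDiff Topology RealInnerProductSpace Matrix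
open Function Set Metric

noncomputable section

namespace Literature.Topology.FourManifolds

/-- Local notation: `𝔼 n` is the model Euclidean space `EuclideanSpace ℝ (Fin n)`. -/
local notation "𝔼 " n:arg => EuclideanSpace ℝ (Fin n)

/-- Local notation: `𝕊 n` is the unit sphere in `EuclideanSpace ℝ (Fin (n + 1))`. -/
local notation "𝕊 " n:arg => (Metric.sphere (0 : EuclideanSpace ℝ (Fin (n + 1))) 1)

attribute [local instance] fact_finrank_euclideanSpace_two fact_finrank_euclideanSpace_four

/-! ### Complements on the normal field of a patch (`BandThickening.lean`) -/

section Normal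

variable {β : 𝔼 2 → 𝕊 3}

/-- `frameCoord p` is additive. [folklore] -/
theorem frameCoord_add (p x y : 𝔼 4) : frameCoord p (x + y) = frameCoord p x + frameCoord p y := by
  funext m; exact inner_add_left _ _ _

/-- `frameCoord p` is homogeneous. [folklore] -/
theorem frameCoord_smul (p : 𝔼 4) (r : ℝ) (x : 𝔼 4) : frameCoord p (r • x) = r • frameCoord p x := by
  funext m; exact inner_smul_left_eq_smul _ _ _

/-- `frameLift p 0 = 0`. [folklore] -/
theorem frameLift_zero (p : 𝔼 4) : frameLift p 0 = 0 := by
  simp [frameLift]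

/-- **Where the normal field of a patch does not vanish, the patch is an immersion** (converse of
`patchNormal_ne_zero`): a nonzero cross product of the frame coordinates of `∂₀β`, `∂₁β` makes
them, hence `∂₀β`, `∂₁β`, linearly independent. [folklore] -/
theorem injective_fderiv_of_patchNormal_ne_zero {x : 𝔼 2} (hN : patchNormal β x ≠ 0) :
    Injective (fderiv ℝ (fun y ↦ ((β y : 𝕊 3) : 𝔼 4)) x) := by
  set p : 𝔼 4 := ((β x : 𝕊 3) : 𝔼 4) with hp
  set a : Fin 2 → (Fin 3 → ℝ) := fun i ↦ frameCoord p (patchPartial β i x) with ha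
  have hcross : a 0 ⨯₃ a 1 ≠ 0 := fun h0 ↦ hN (by
    change frameLift p (a 0 ⨯₃ a 1) = 0
    rw [h0, frameLift_zero])
  have hli := crossProduct_ne_zero_iff_linearIndependent.1 hcross
  rw [LinearIndependent.pair_iff] at hli
  intro v w hvw
  have h0 : fderiv ℝ (fun y ↦ ((β y : 𝕊 3) : 𝔼 4)) x (v - w) = 0 := by rw [map_sub, hvw, sub_self]
  rw [eq_smul_single_add (v - w), map_add, map_smul, map_smul] at h0
  change (v - w) 0 • patchPartial β 0 x + (v - w) 1 • patchPartial β 1 x = 0 at h0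
  have h1 := congrArg (frameCoord p) h0
  rw [frameCoord_add, frameCoord_smul, frameCoord_smul,
    show frameCoord p 0 = 0 from by funext m; exact inner_zero_left _] at h1
  obtain ⟨h2, h3⟩ := hli _ _ h1
  simp only [PiLp.sub_apply, sub_eq_zero] at h2 h3
  rw [eq_smul_single_add v, eq_smul_single_add w, h2, h3]

/-- **Ambient versus intrinsic differential** (converse of `injective_fderiv_coe_patch`): if the
differential of the patch read in `ℝ⁴` is injective, so is its manifold differential into
`T S³` (chain rule with the inclusion). [folklore] -/
theorem injective_mfderiv_of_injective_fderiv_coe (hβ : ContMDiff 𝓘(ℝ, 𝔼 2) (𝓡 3) ∞ β) {x : 𝔼 2}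
    (hx : Injective (fderiv ℝ (fun y ↦ ((β y : 𝕊 3) : 𝔼 4)) x)) :
    Injective (mfderiv 𝓘(ℝ, 𝔼 2) (𝓡 3) β x) := by
  have hn : (∞ : WithTop ℕ∞) ≠ 0 := by simp
  have hcomp : fderiv ℝ (fun y ↦ ((β y : 𝕊 3) : 𝔼 4)) x =
      (mfderiv (𝓡 3) 𝓘(ℝ, 𝔼 4) (Subtype.val : 𝕊 3 → 𝔼 4) (β x)).comp
        (mfderiv 𝓘(ℝ, 𝔼 2) (𝓡 3) β x) := by
    rw [← mfderiv_eq_fderiv]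
    exact mfderiv_comp x (contMDiff_coe_sphere.mdifferentiableAt hn) (hβ.mdifferentiableAt hn)
  have hfun : ⇑(fderiv ℝ (fun y ↦ ((β y : 𝕊 3) : 𝔼 4)) x) =
      ⇑(mfderiv (𝓡 3) 𝓘(ℝ, 𝔼 4) (Subtype.val : 𝕊 3 → 𝔼 4) (β x)) ∘
        ⇑(mfderiv 𝓘(ℝ, 𝔼 2) (𝓡 3) β x) := by
    rw [hcomp]; rfl
  rw [hfun] at hx
  exact hx.of_comp

/-- The non-vanishing locus of the normal field is open. [folklore] -/
theorem isOpen_patchNormal_ne_zero (hβ : ContMDiff 𝓘(ℝ, 𝔼 2) (𝓡 3) ∞ β) :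
    IsOpen {x | patchNormal β x ≠ 0} :=
  isOpen_ne_fun (contDiff_patchNormal hβ).continuous continuous_const

end Normal

/-! ### A closed ball slightly larger than the unit disc inside an open set -/

section Ball

/-- **A closed disc of radius `1 + η` inside any neighbourhood of the closed unit disc** of a
real normed space with compact closed balls (Mathlib: `IsCompact.exists_cthickening_subset_open`,
`cthickening_closedBall`). [folklore] -/
theorem exists_closedBall_subset_of_closedBall_subset {F : Type*} [NormedAddCommGroup F]
    [NormedSpace ℝ F] [ProperSpace F] {U : Set F} (hU : IsOpen U) (hDU : closedBall (0 : F) 1 ⊆ U) :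
    ∃ η : ℝ, 0 < η ∧ closedBall (0 : F) (1 + η) ⊆ U := by
  obtain ⟨η, hη, hsub⟩ := (isCompact_closedBall (0 : F) 1).exists_cthickening_subset_open hU hDU
  refine ⟨η, hη, ?_⟩
  rw [cthickening_closedBall hη.le zero_le_one, add_comm] at hsub
  exact hsub

end Ball

/-! ### The disc reparametrised over the whole plane -/

section Reparam

variable (d : 𝔼 2 → 𝕊 3) (R : ℝ)

/-- The disc map precomposed with Mathlib's diffeomorphism `univBall 0 R : ℝ² ≅ B(0, R)`:
a smooth map on the whole plane which is an immersion wherever `d` is one on the ball. [folklore] -/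
def discB (x : 𝔼 2) : 𝕊 3 := d (OpenPartialHomeomorph.univBall (0 : 𝔼 2) R x)

/-- The normal field of the reparametrised disc: the normal field of `d` at the image point. [folklore] -/
def normalB (x : 𝔼 2) : 𝔼 4 := patchNormal d (OpenPartialHomeomorph.univBall (0 : 𝔼 2) R x)

/-- The one-element normal framing `(normalB)` of the reparametrised disc. [folklore] -/
def framingB : Fin 1 → 𝔼 2 → 𝔼 4 := fun _ ↦ normalB d R

variable {d R}

/-- Unfolding of `discB`. [folklore] -/
theorem discB_apply (x : 𝔼 2) : discB d R x = d (OpenPartialHomeomorph.univBall (0 : 𝔼 2) R x) := rfl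

/-- The reparametrised disc is smooth. [folklore] -/
theorem contMDiff_discB (hd : ContMDiff 𝓘(ℝ, 𝔼 2) (𝓡 3) ∞ d) :
    ContMDiff 𝓘(ℝ, 𝔼 2) (𝓡 3) ∞ (discB d R) :=
  hd.comp OpenPartialHomeomorph.contDiff_univBall.contMDiff

/-- The reparametrised disc read in `ℝ⁴` is `(ι ∘ d) ∘ univBall`. [folklore] -/
theorem coe_discB_eq_comp : (fun y ↦ ((discB d R y : 𝕊 3) : 𝔼 4)) =
    (fun y ↦ ((d y : 𝕊 3) : 𝔼 4)) ∘ OpenPartialHomeomorph.univBall (0 : 𝔼 2) R :=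
  rfl

/-- **The differential of `univBall 0 R` is injective** (it has a differentiable left inverse on
the ball, `R > 0`). [folklore] -/
theorem injective_fderiv_univBall (hR : 0 < R) (x : 𝔼 2) :
    Injective (fderiv ℝ (OpenPartialHomeomorph.univBall (0 : 𝔼 2) R) x) := by
  set ρ := OpenPartialHomeomorph.univBall (0 : 𝔼 2) R with hρ
  have hxt : ρ x ∈ ball (0 : 𝔼 2) R := by
    rw [← OpenPartialHomeomorph.univBall_target (0 : 𝔼 2) hR]
    exact ρ.map_source (by rw [OpenPartialHomeomorph.univBall_source]; exact mem_univ x)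
  have hρd : DifferentiableAt ℝ ρ x :=
    ((OpenPartialHomeomorph.contDiff_univBall (n := (⊤ : ℕ∞))).differentiable (by simp)) x
  have hsd : DifferentiableAt ℝ ρ.symm (ρ x) :=
    ((OpenPartialHomeomorph.contDiffOn_univBall_symm (n := (⊤ : ℕ∞))).differentiableOn (by simp)).differentiableAt
      (isOpen_ball.mem_nhds hxt)
  have hcomp : fderiv ℝ (ρ.symm ∘ ρ) x = (fderiv ℝ ρ.symm (ρ x)).comp (fderiv ℝ ρ x) :=
    fderiv_comp x hsd hρd
  have hid : ρ.symm ∘ ρ = id := by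
    funext y
    exact ρ.left_inv (by rw [OpenPartialHomeomorph.univBall_source]; exact mem_univ y)
  rw [hid, fderiv_id] at hcomp
  have hinj : Injective ((fderiv ℝ ρ.symm (ρ x)).comp (fderiv ℝ ρ x)) := by
    rw [← hcomp]; exact injective_id
  rw [ContinuousLinearMap.coe_comp] at hinj
  exact hinj.of_comp

/-- **The reparametrised disc is an immersion** where the normal field of `d` does not vanish on
the ball (`R > 0`). [folklore] -/
theorem injective_mfderiv_discB (hd : ContMDiff 𝓘(ℝ, 𝔼 2) (𝓡 3) ∞ d) (hR : 0 < R)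
    (hN : ∀ y ∈ ball (0 : 𝔼 2) R, patchNormal d y ≠ 0) (x : 𝔼 2) :
    Injective (mfderiv 𝓘(ℝ, 𝔼 2) (𝓡 3) (discB d R) x) := by
  set ρ := OpenPartialHomeomorph.univBall (0 : 𝔼 2) R with hρ
  have hxt : ρ x ∈ ball (0 : 𝔼 2) R := by
    rw [← OpenPartialHomeomorph.univBall_target (0 : 𝔼 2) hR]
    exact ρ.map_source (by rw [OpenPartialHomeomorph.univBall_source]; exact mem_univ x)
  refine injective_mfderiv_of_injective_fderiv_coe (contMDiff_discB hd) ?_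
  rw [coe_discB_eq_comp]
  have hdd : DifferentiableAt ℝ (fun y ↦ ((d y : 𝕊 3) : 𝔼 4)) (ρ x) :=
    (contDiff_coe_patch hd).differentiable (by simp) _
  have hρd : DifferentiableAt ℝ ρ x :=
    ((OpenPartialHomeomorph.contDiff_univBall (n := (⊤ : ℕ∞))).differentiable (by simp)) x
  rw [fderiv_comp x hdd hρd, ContinuousLinearMap.coe_comp]
  exact (injective_fderiv_of_patchNormal_ne_zero (hN _ hxt)).comp (injective_fderiv_univBall hR x)

/-- **The normal field gives a normal framing of the reparametrised disc** (where it does not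
vanish on the ball): smooth, tangent to the sphere, and independent of the image of the
differential (it is orthogonal to it and nonzero). [folklore] -/
theorem isNormalFraming_framingB (hd : ContMDiff 𝓘(ℝ, 𝔼 2) (𝓡 3) ∞ d) (hR : 0 < R)
    (hN : ∀ y ∈ ball (0 : 𝔼 2) R, patchNormal d y ≠ 0) :
    IsNormalFraming 𝓘(ℝ, 𝔼 2) (discB d R) (framingB d R) where
  contMDiff _ := ((contDiff_patchNormal hd).comp OpenPartialHomeomorph.contDiff_univBall).contMDiff
  inner_eq_zero _ x := inner_patchNormal_self _
  eq_zero_of_eq x v a h0 := by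
    set ρ := OpenPartialHomeomorph.univBall (0 : 𝔼 2) R with hρ
    have hxt : ρ x ∈ ball (0 : 𝔼 2) R := by
      rw [← OpenPartialHomeomorph.univBall_target (0 : 𝔼 2) hR]
      exact ρ.map_source (by rw [OpenPartialHomeomorph.univBall_source]; exact mem_univ x)
    -- the ambient derivative is a value of `Dd` at `ρ x`
    have hamb : ambientDeriv 𝓘(ℝ, 𝔼 2) (discB d R) x v =
        fderiv ℝ (fun y ↦ ((d y : 𝕊 3) : 𝔼 4)) (ρ x) (fderiv ℝ ρ x v) := by
      rw [ambientDeriv_apply, mfderiv_eq_fderiv]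
      change fderiv ℝ (fun y ↦ ((discB d R y : 𝕊 3) : 𝔼 4)) x v = _
      rw [coe_discB_eq_comp]
      have hdd : DifferentiableAt ℝ (fun y ↦ ((d y : 𝕊 3) : 𝔼 4)) (ρ x) :=
        (contDiff_coe_patch hd).differentiable (by simp) _
      have hρd : DifferentiableAt ℝ ρ x :=
        ((OpenPartialHomeomorph.contDiff_univBall (n := (⊤ : ℕ∞))).differentiable (by simp)) x
      rw [fderiv_comp x hdd hρd]
      rfl
    rw [Fin.sum_univ_one] at h0
    change ambientDeriv 𝓘(ℝ, 𝔼 2) (discB d R) x v + a 0 • patchNormal d (ρ x) = 0 at h0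
    have h1 := congrArg (fun w ↦ ⟪patchNormal d (ρ x), w⟫) h0
    simp only [inner_add_right, inner_smul_right, inner_zero_right, hamb,
      inner_patchNormal_fderiv, zero_add] at h1
    have hNN : ⟪patchNormal d (ρ x), patchNormal d (ρ x)⟫ ≠ 0 := by
      rw [real_inner_self_eq_norm_sq]
      exact pow_ne_zero 2 (norm_ne_zero_iff.2 (hN _ hxt))
    have ha0 : a 0 = 0 := (mul_eq_zero.1 h1).resolve_right hNN
    funext i
    fin_cases i
    exact ha0

/-- `dim ℝ² + 1 = 3`. [folklore] -/
theorem finrank_two_add_one : Module.finrank ℝ (𝔼 2) + 1 = 3 := by simp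

/-- **The core map of the normal framing is a local diffeomorphism along the zero section.** [folklore] -/
theorem isLocalDiffeomorphAt_core_zero_framingB (hd : ContMDiff 𝓘(ℝ, 𝔼 2) (𝓡 3) ∞ d) (hR : 0 < R)
    (hN : ∀ y ∈ ball (0 : 𝔼 2) R, patchNormal d y ≠ 0) (x : 𝔼 2) :
    IsLocalDiffeomorphAt (𝓘(ℝ, 𝔼 2).prod 𝓘(ℝ, 𝔼 1)) (𝓡 3) ∞
      (isNormalFraming_framingB hd hR hN).core ((x, 0) : (𝔼 2) × 𝔼 1) :=
  (isNormalFraming_framingB hd hR hN).isLocalDiffeomorphAt_core_zero (contMDiff_discB hd)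
    (injective_mfderiv_discB hd hR hN) finrank_two_add_one x

end Reparam

/-! ### The radius: the disc is an immersion slightly beyond the unit disc -/

section Radius

variable {d : 𝔼 2 → 𝕊 3}

/-- **For a smooth disc the normal field is nonzero on a closed disc of radius `1 + η`**: it is
nonzero on the closed unit disc (`d` is an immersion there, `patchNormal_ne_zero`) and the
nonvanishing locus is open. [folklore] -/
theorem exists_radius_patchNormal_ne_zero (hd : IsSmoothDisc d) :
    ∃ η : ℝ, 0 < η ∧ ∀ y ∈ closedBall (0 : 𝔼 2) (1 + η), patchNormal d y ≠ 0 := by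
  have hsub : closedBall (0 : 𝔼 2) 1 ⊆ {y | patchNormal d y ≠ 0} := fun y hy ↦
    patchNormal_ne_zero hd.1 (injective_fderiv_coe_patch hd.1 (hd.2.2 y hy))
  obtain ⟨η, hη, hball⟩ := exists_closedBall_subset_of_closedBall_subset
    (isOpen_patchNormal_ne_zero hd.1) hsub
  exact ⟨η, hη, fun y hy ↦ hball hy⟩

end Radius

/-! ### The flattening chart of a smooth disc -/

section Chart

variable {K : Knot} {d : 𝔼 2 → 𝕊 3} (hd : IsSmoothDisc d) (hdK : ∀ x : 𝕊 1, d x = K x)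

/-- Local injectivity from a local diffeomorphism (any manifolds). [folklore] -/
theorem exists_nhds_injOn_of_isLocalDiffeomorphAt {E H E' H' : Type*} [NormedAddCommGroup E]
    [NormedSpace ℝ E] [TopologicalSpace H] [NormedAddCommGroup E'] [NormedSpace ℝ E']
    [TopologicalSpace H'] {I : ModelWithCorners ℝ E H} {J : ModelWithCorners ℝ E' H'}
    {M : Type*} [TopologicalSpace M] [ChartedSpace H M] {N : Type*} [TopologicalSpace N]
    [ChartedSpace H' N] {n : WithTop ℕ∞} {f : M → N} {x : M} (h : IsLocalDiffeomorphAt I J n f x) :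
    ∃ U ∈ 𝓝 x, InjOn f U := by
  obtain ⟨e, hxe, heq⟩ := h
  exact ⟨e.source, e.open_source.mem_nhds hxe, fun a ha b hb hab ↦
    e.toPartialEquiv.injOn ha hb (by rw [← heq ha, ← heq hb]; exact hab)⟩

namespace FlatteningChart

/-- The margin `η > 0` of the disc: `d` is an immersion on the closed disc of radius `1 + η`. [folklore] -/
def margin (hd : IsSmoothDisc d) : ℝ := Classical.choose (exists_radius_patchNormal_ne_zero hd)

/-- The margin is positive. [folklore] -/
theorem margin_pos : 0 < margin hd := (Classical.choose_spec (exists_radius_patchNormal_ne_zero hd)).1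

/-- The normal field does not vanish on the closed disc of radius `1 + margin`. [folklore] -/
theorem patchNormal_ne_zero_of_mem {y : 𝔼 2} (hy : y ∈ closedBall (0 : 𝔼 2) (1 + margin hd)) :
    patchNormal d y ≠ 0 :=
  (Classical.choose_spec (exists_radius_patchNormal_ne_zero hd)).2 y hy

/-- The radius `R = 1 + margin` of the reparametrisation ball. [folklore] -/
def radius (hd : IsSmoothDisc d) : ℝ := 1 + margin hd

/-- `1 < R`. [folklore] -/
theorem one_lt_radius : 1 < radius hd := by unfold radius; linarith [margin_pos hd]

/-- `0 < R`. [folklore] -/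
theorem radius_pos : 0 < radius hd := one_pos.trans (one_lt_radius hd)

/-- The normal field does not vanish on the open ball of radius `R`. [folklore] -/
theorem patchNormal_ne_zero_of_mem_ball {y : 𝔼 2} (hy : y ∈ ball (0 : 𝔼 2) (radius hd)) :
    patchNormal d y ≠ 0 :=
  patchNormal_ne_zero_of_mem hd (ball_subset_closedBall hy)

/-- The closed unit disc lies in the open ball of radius `R`. [folklore] -/
theorem unit_closedBall_subset_ball : closedBall (0 : 𝔼 2) 1 ⊆ ball (0 : 𝔼 2) (radius hd) :=
  Metric.closedBall_subset_ball (one_lt_radius hd)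

/-- The reparametrisation `ρ = univBall 0 R : ℝ² ≅ B(0, R)`. [folklore] -/
def ρ (hd : IsSmoothDisc d) : OpenPartialHomeomorph (𝔼 2) (𝔼 2) :=
  OpenPartialHomeomorph.univBall (0 : 𝔼 2) (radius hd)

/-- `ρ` is defined everywhere. [folklore] -/
theorem ρ_source : (ρ hd).source = univ := OpenPartialHomeomorph.univBall_source _ _

/-- The target of `ρ` is the ball of radius `R`. [folklore] -/
theorem ρ_target : (ρ hd).target = ball (0 : 𝔼 2) (radius hd) :=
  OpenPartialHomeomorph.univBall_target _ (radius_pos hd)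

/-- `ρ x` lies in the ball of radius `R`. [folklore] -/
theorem ρ_mem_ball (x : 𝔼 2) : ρ hd x ∈ ball (0 : 𝔼 2) (radius hd) := by
  rw [← ρ_target hd]; exact (ρ hd).map_source (by rw [ρ_source]; exact mem_univ x)

/-- `ρ (ρ⁻¹ y) = y` on the ball. [folklore] -/
theorem ρ_symm_apply {y : 𝔼 2} (hy : y ∈ ball (0 : 𝔼 2) (radius hd)) : ρ hd ((ρ hd).symm y) = y :=
  (ρ hd).right_inv (by rw [ρ_target]; exact hy)

/-- `ρ⁻¹ (ρ x) = x`. [folklore] -/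
theorem symm_ρ_apply (x : 𝔼 2) : (ρ hd).symm (ρ hd x) = x :=
  (ρ hd).left_inv (by rw [ρ_source]; exact mem_univ x)

/-- The normal framing of the reparametrised disc. [folklore] -/
theorem framing : IsNormalFraming 𝓘(ℝ, 𝔼 2) (discB d (radius hd)) (framingB d (radius hd)) :=
  isNormalFraming_framingB hd.1 (radius_pos hd) fun _ hy ↦ patchNormal_ne_zero_of_mem_ball hd hy

/-- **The thick disc**: the core map `(x, u) ↦ (d (ρ x) + u₀ N (ρ x)) / ‖…‖` of the normal
framing of the reparametrised disc. [folklore] -/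
def core (hd : IsSmoothDisc d) : (𝔼 2) × 𝔼 1 → 𝕊 3 := (framing hd).core

/-- On the zero section the thick disc is the reparametrised disc. [folklore] -/
theorem core_zero (x : 𝔼 2) : core hd (x, 0) = d (ρ hd x) := (framing hd).core_zero x

/-- The thick disc is continuous. [folklore] -/
theorem continuous_core : Continuous (core hd) := (framing hd).continuous_core (contMDiff_discB hd.1)

/-- The thick disc is a local diffeomorphism along the zero section. [folklore] -/
theorem isLocalDiffeomorphAt_core_zero (x : 𝔼 2) :
    IsLocalDiffeomorphAt (𝓘(ℝ, 𝔼 2).prod 𝓘(ℝ, 𝔼 1)) (𝓡 3) ∞ (core hd) ((x, 0) : (𝔼 2) × 𝔼 1) :=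
  isLocalDiffeomorphAt_core_zero_framingB hd.1 (radius_pos hd)
    (fun _ hy ↦ patchNormal_ne_zero_of_mem_ball hd hy) x

/-- The pulled-back closed unit disc `K' = ρ⁻¹ (D̄²)`, a compact subset of the plane. [folklore] -/
def discK (hd : IsSmoothDisc d) : Set (𝔼 2) := (ρ hd).symm '' closedBall (0 : 𝔼 2) 1

/-- `K'` is compact. [folklore] -/
theorem isCompact_discK : IsCompact (discK hd) :=
  (isCompact_closedBall _ _).image_of_continuousOn
    ((OpenPartialHomeomorph.continuousOn_univBall_symm _ _).mono (unit_closedBall_subset_ball hd))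

/-- Points of `K'` map into the closed unit disc under `ρ`. [folklore] -/
theorem ρ_mem_closedBall_of_mem_discK {x : 𝔼 2} (hx : x ∈ discK hd) :
    ρ hd x ∈ closedBall (0 : 𝔼 2) 1 := by
  obtain ⟨y, hy, rfl⟩ := hx
  rw [ρ_symm_apply hd (unit_closedBall_subset_ball hd hy)]; exact hy

/-- The zero section over `K'`. [folklore] -/
def zeroK (hd : IsSmoothDisc d) : Set ((𝔼 2) × 𝔼 1) := discK hd ×ˢ ({0} : Set (𝔼 1))

/-- The zero section over `K'` is compact. [folklore] -/
theorem isCompact_zeroK : IsCompact (zeroK hd) := (isCompact_discK hd).prod isCompact_singleton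

/-- **The thick disc is injective on an open neighbourhood of the zero section over `K'`**
(injective on it by the injectivity of `d` on the closed unit disc, locally injective and
continuous there; `exists_isOpen_injOn_of_isCompact`). [folklore] -/
theorem exists_isOpen_injOn_core :
    ∃ V : Set ((𝔼 2) × 𝔼 1), IsOpen V ∧ zeroK hd ⊆ V ∧ InjOn (core hd) V := by
  refine exists_isOpen_injOn_of_isCompact (isCompact_zeroK hd)
    (fun q _ ↦ (continuous_core hd).continuousAt) ?_ ?_
  · rintro ⟨x, u⟩ ⟨hx, hu⟩ ⟨x', u'⟩ ⟨hx', hu'⟩ h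
    rw [mem_singleton_iff] at hu hu'
    subst hu hu'
    rw [core_zero, core_zero] at h
    have h1 : ρ hd x = ρ hd x' :=
      hd.2.1 (ρ_mem_closedBall_of_mem_discK hd hx) (ρ_mem_closedBall_of_mem_discK hd hx') h
    have h2 := congrArg (ρ hd).symm h1
    rw [symm_ρ_apply, symm_ρ_apply] at h2
    rw [h2]
  · rintro ⟨x, u⟩ ⟨-, hu⟩
    rw [mem_singleton_iff] at hu
    subst hu
    exact exists_nhds_injOn_of_isLocalDiffeomorphAt (isLocalDiffeomorphAt_core_zero hd x)

/-- The good region: injectivity neighbourhood intersected with the local-diffeomorphism locus. [folklore] -/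
def good (hd : IsSmoothDisc d) : Set ((𝔼 2) × 𝔼 1) :=
  Classical.choose (exists_isOpen_injOn_core hd) ∩
    {q | IsLocalDiffeomorphAt (𝓘(ℝ, 𝔼 2).prod 𝓘(ℝ, 𝔼 1)) (𝓡 3) ∞ (core hd) q}

/-- The good region is open. [folklore] -/
theorem isOpen_good : IsOpen (good hd) :=
  (Classical.choose_spec (exists_isOpen_injOn_core hd)).1.inter (isOpen_setOf_isLocalDiffeomorphAt _)

/-- The zero section over `K'` lies in the good region. [folklore] -/
theorem zeroK_subset_good : zeroK hd ⊆ good hd := fun q hq ↦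
  ⟨(Classical.choose_spec (exists_isOpen_injOn_core hd)).2.1 hq, by
    obtain ⟨x, u⟩ := q
    obtain ⟨-, hu⟩ := hq
    rw [mem_singleton_iff] at hu
    subst hu
    exact isLocalDiffeomorphAt_core_zero hd x⟩

/-- The thick disc is injective on the good region. [folklore] -/
theorem injOn_core_good : InjOn (core hd) (good hd) :=
  (Classical.choose_spec (exists_isOpen_injOn_core hd)).2.2.mono inter_subset_left

/-- The thick disc is a local diffeomorphism on the good region. [folklore] -/
theorem isLocalDiffeomorphAt_core_of_mem_good {q : (𝔼 2) × 𝔼 1} (hq : q ∈ good hd) :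
    IsLocalDiffeomorphAt (𝓘(ℝ, 𝔼 2).prod 𝓘(ℝ, 𝔼 1)) (𝓡 3) ∞ (core hd) q := hq.2

/-! #### The straightening map `Λ : ℝ³ ⊇ {(x, y) ∈ B(0, R)} ≅ ℝ² × ℝ¹` -/

/-- The straightening map `(x, y, z) ↦ (ρ⁻¹ (x, y), z)`. [folklore] -/
def Λ (hd : IsSmoothDisc d) (p : 𝔼 3) : (𝔼 2) × 𝔼 1 :=
  ((ρ hd).symm (BlowDownFlat.xy p), EuclideanSpace.single 0 (p 2))

/-- Its inverse `(x, u) ↦ (ρ x, u₀)`. [folklore] -/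
def Λinv (hd : IsSmoothDisc d) (q : (𝔼 2) × 𝔼 1) : 𝔼 3 := BlowDownFlat.mk3 (ρ hd q.1) (q.2 0)

/-- A vector of `ℝ¹` is `single 0` of its coordinate. [folklore] -/
theorem _root_.Literature.Topology.FourManifolds.euclideanSpace_one_eq_single (u : 𝔼 1) :
    EuclideanSpace.single 0 (u 0) = u := by
  ext i; fin_cases i; simp

/-- `Λ ∘ Λinv = id`. [folklore] -/
theorem Λ_Λinv (q : (𝔼 2) × 𝔼 1) : Λ hd (Λinv hd q) = q := by
  obtain ⟨x, u⟩ := q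
  simp only [Λ, Λinv, BlowDownFlat.xy_mk3, BlowDownFlat.mk3_apply_two, symm_ρ_apply,
    euclideanSpace_one_eq_single]

/-- `Λinv ∘ Λ = id` on `{(x, y) ∈ B(0, R)}`. [folklore] -/
theorem Λinv_Λ {p : 𝔼 3} (hp : BlowDownFlat.xy p ∈ ball (0 : 𝔼 2) (radius hd)) :
    Λinv hd (Λ hd p) = p := by
  change BlowDownFlat.mk3 (ρ hd ((ρ hd).symm (BlowDownFlat.xy p)))
    ((EuclideanSpace.single (0 : Fin 1) (p 2)) 0) = p
  rw [ρ_symm_apply hd hp]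
  have : (EuclideanSpace.single (0 : Fin 1) (p 2)) 0 = p 2 := by simp
  rw [this, BlowDownFlat.mk3_xy]

/-- **The straightening map as a partial diffeomorphism** `{(x, y) ∈ B(0, R)} ≅ ℝ² × ℝ¹`. [folklore] -/
def ΛPD (hd : IsSmoothDisc d) :
    PartialDiffeomorph 𝓘(ℝ, 𝔼 3) (𝓘(ℝ, 𝔼 2).prod 𝓘(ℝ, 𝔼 1)) (𝔼 3) ((𝔼 2) × 𝔼 1) ∞ where
  toFun := Λ hd
  invFun := Λinv hd
  source := {p | BlowDownFlat.xy p ∈ ball (0 : 𝔼 2) (radius hd)}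
  target := univ
  map_source' _ _ := mem_univ _
  map_target' q _ := by
    change BlowDownFlat.xy (BlowDownFlat.mk3 (ρ hd q.1) (q.2 0)) ∈ ball (0 : 𝔼 2) (radius hd)
    rw [BlowDownFlat.xy_mk3]; exact ρ_mem_ball hd _
  left_inv' _ hp := Λinv_Λ hd hp
  right_inv' q _ := Λ_Λinv hd q
  open_source := isOpen_ball.preimage BlowDownFlat.contDiff_xy.continuous
  open_target := isOpen_univ
  contMDiffOn_toFun := by
    have h1 : ContMDiffOn 𝓘(ℝ, 𝔼 2) 𝓘(ℝ, 𝔼 2) ∞ (ρ hd).symm (ball 0 (radius hd)) :=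
      (OpenPartialHomeomorph.contDiffOn_univBall_symm (n := (⊤ : ℕ∞))).contMDiffOn
    have hA : ContMDiffOn 𝓘(ℝ, 𝔼 3) 𝓘(ℝ, 𝔼 2) ∞ (fun p : 𝔼 3 ↦ (ρ hd).symm (BlowDownFlat.xy p))
        {p | BlowDownFlat.xy p ∈ ball (0 : 𝔼 2) (radius hd)} :=
      h1.comp BlowDownFlat.contDiff_xy.contMDiff.contMDiffOn (fun p hp ↦ hp)
    have hB : ContMDiff 𝓘(ℝ, 𝔼 3) 𝓘(ℝ, 𝔼 1) ∞ (fun p : 𝔼 3 ↦ EuclideanSpace.single (0 : Fin 1) (p 2)) := by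
      have : (fun p : 𝔼 3 ↦ EuclideanSpace.single (0 : Fin 1) (p 2)) =
          fun p ↦ (p 2) • EuclideanSpace.single (0 : Fin 1) (1 : ℝ) := by
        funext p; ext i; fin_cases i; simp
      rw [this]
      exact ((BlowDownFlat.contDiff_apply_euclidean 2).smul contDiff_const).contMDiff
    exact hA.prodMk hB.contMDiffOn
  contMDiffOn_invFun := by
    refine ContMDiff.contMDiffOn ?_
    have h1 : ContMDiff (𝓘(ℝ, 𝔼 2).prod 𝓘(ℝ, 𝔼 1)) 𝓘(ℝ, 𝔼 2) ∞ fun q : (𝔼 2) × 𝔼 1 ↦ ρ hd q.1 :=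
      (OpenPartialHomeomorph.contDiff_univBall (n := (⊤ : ℕ∞))).contMDiff.comp contMDiff_fst
    have h2 : ContMDiff (𝓘(ℝ, 𝔼 2).prod 𝓘(ℝ, 𝔼 1)) 𝓘(ℝ, ℝ) ∞ fun q : (𝔼 2) × 𝔼 1 ↦ q.2 0 :=
      (BlowDownFlat.contDiff_apply_euclidean (n := 1) 0).contMDiff.comp contMDiff_snd
    exact BlowDownFlat.contDiff_mk3.contMDiff.comp (h1.prodMk_space h2)

/-- The thick disc in straightened coordinates: `Γ = core ∘ Λ`. [folklore] -/
def Γ (hd : IsSmoothDisc d) (p : 𝔼 3) : 𝕊 3 := core hd (Λ hd p)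

/-- The domain of the chart. [folklore] -/
def Ω (hd : IsSmoothDisc d) : Set (𝔼 3) :=
  {p | BlowDownFlat.xy p ∈ ball (0 : 𝔼 2) (radius hd)} ∩ Λ hd ⁻¹' good hd

/-- The domain of the chart is open. [folklore] -/
theorem isOpen_Ω : IsOpen (Ω hd) :=
  (ΛPD hd).contMDiffOn_toFun.continuousOn.isOpen_inter_preimage (ΛPD hd).open_source (isOpen_good hd)

/-- `Γ` of a point of the flat disc plane: `Γ (x, 0) = d x` for `x` in the ball. [folklore] -/
theorem Γ_mk3_zero {x : 𝔼 2} (hx : x ∈ ball (0 : 𝔼 2) (radius hd)) :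
    Γ hd (BlowDownFlat.mk3 x 0) = d x := by
  rw [Γ, Λ, BlowDownFlat.xy_mk3, BlowDownFlat.mk3_apply_two]
  have : EuclideanSpace.single (0 : Fin 1) (0 : ℝ) = 0 := by ext i; simp
  rw [this, core_zero, ρ_symm_apply hd hx]

/-- A point of the flat closed unit disc, straightened, lies on the zero section over `K'`. [folklore] -/
theorem Λ_mem_zeroK {p : 𝔼 3} (hp : p ∈ BlowDownFlat.flatDisc) : Λ hd p ∈ zeroK hd := by
  obtain ⟨hz, hr⟩ := hp
  have hxy : BlowDownFlat.xy p ∈ closedBall (0 : 𝔼 2) 1 := by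
    rw [mem_closedBall_zero_iff, ← Real.sqrt_sq (norm_nonneg _), ← BlowDownFlat.sq_add_sq_eq_norm_xy_sq,
      Real.sqrt_le_one]
    exact hr
  refine ⟨⟨BlowDownFlat.xy p, hxy, rfl⟩, ?_⟩
  rw [mem_singleton_iff]
  change EuclideanSpace.single (0 : Fin 1) (p 2) = 0
  rw [hz]
  ext i; simp

/-- **The flattening chart of a smooth spanning disc.** [folklore] -/
def flatChart (hd : IsSmoothDisc d) (hdK : ∀ x : 𝕊 1, d x = K x) : Knot.FlatChart K where
  Ω := Ω hd
  isOpen_Ω := isOpen_Ω hd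
  Γ := Γ hd
  isLocalDiffeomorphAt p hp :=
    IsLocalDiffeomorphAt.comp
      (hf := PartialDiffeomorph.isLocalDiffeomorphAt 𝓘(ℝ, 𝔼 3) (𝓘(ℝ, 𝔼 2).prod 𝓘(ℝ, 𝔼 1)) ∞
        (ΛPD hd) hp.1)
      (hg := isLocalDiffeomorphAt_core_of_mem_good hd hp.2)
  injOn p hp p' hp' h := by
    have h1 : Λ hd p = Λ hd p' := injOn_core_good hd hp.2 hp'.2 h
    rw [← Λinv_Λ hd hp.1, ← Λinv_Λ hd hp'.1, h1]
  flatDisc_subset p hp := by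
    refine ⟨?_, zeroK_subset_good hd (Λ_mem_zeroK hd hp)⟩
    obtain ⟨hz, hr⟩ := hp
    change BlowDownFlat.xy p ∈ ball (0 : 𝔼 2) (radius hd)
    refine unit_closedBall_subset_ball hd ?_
    rw [mem_closedBall_zero_iff, ← Real.sqrt_sq (norm_nonneg _), ← BlowDownFlat.sq_add_sq_eq_norm_xy_sq,
      Real.sqrt_le_one]
    exact hr
  apply_flatCircle u := by
    change Γ hd (BlowDownFlat.mk3 u 0) = K u
    rw [Γ_mk3_zero hd (unit_closedBall_subset_ball hd (mem_closedBall_zero_iff.2 (norm_eq_of_mem_sphere u).le)),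
      hdK]

/-- The flattening chart extends the spanning disc: `Γ (x, 0) = d x` for `‖x‖ ≤ 1`. [folklore] -/
theorem flatChart_apply_mk3 {x : 𝔼 2} (hx : ‖x‖ ≤ 1) : (flatChart hd hdK).Γ (BlowDownFlat.mk3 x 0) = d x :=
  Γ_mk3_zero hd (unit_closedBall_subset_ball hd (mem_closedBall_zero_iff.2 hx))

end FlatteningChart

/-- **Existence of flattening charts for smooth spanning discs** (the input of
`Knot.blowDownModel_of_flatCharts`). [folklore] -/
theorem Knot.existsFlatChart_holds : Knot.ExistsFlatChart := fun _ _ hd hdK ↦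
  ⟨FlatteningChart.flatChart hd hdK, fun _ hx ↦ FlatteningChart.flatChart_apply_mk3 hd hdK hx⟩

end Chart

/-- **Leaf (C) of the blow-down move discharged**: `S³` is `±1`-surgery on any smoothly
disc-bounding knot, relative to any neighbourhood of the disc (`Knot.blowDownModel`,
`KirbyMovesBlowDown.lean`) — flat model, transport along a flattening chart, existence of
flattening charts. Kirby (1989), Ch. I §5, Thm. 5.1, move (2); Rolfsen (1976), §9.H.
[cite: Kirby1989, Ch. I §5 Thm 5.1] -/
theorem Knot.blowDownModel_holds : Knot.blowDownModel :=
  Knot.blowDownModel_of_flatCharts Knot.existsFlatChart_holds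

end Literature.Topology.FourManifolds
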